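import Summits.MatrixMultiplication.MatrixMultiplication.Theorems.SoloInformedAbundantUnit
import Literature.Barriers.MatrixMultiplication.RectangularBarrierUpperSupportProofs
import HarnessLib

/-!
# Theorem R: a reversible 111-abundant tensor is a unit tensor (any format)

Solo programme `solo-MatrixMultiplication-informed` (gen 20), claim c210; the kernel form of
constraint C4 of the programme's sharpest statement ("the intermediate tensor of a proof of
`ω = 2` through a fixed tensor must be reversible, `Q̃(t) = R̃(t)`").

**Theorem R** (`ReversibleUnit.unit_of_reversible`).  Let `t ∈ ℂ^{ι×κ×μ}` be concise (any
format) with `dim 𝔞(t) ≥ |ι|` (111-abundance; e.g. minimal border rank) and REVERSIBLE in the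
weak sense `R̃(t) ≤ Q̃(t)`.  Then the format is cubic, `|κ| = |μ| = |ι| =: d`, `Q̃(t) = d`, and
`t ≅ ⟨d⟩`.  Proof: the three flattening ranks of a concise tensor are `|ι|, |κ|, |μ|` and bound
`R̃(t)` from below (`flatteningRank_rotate_le_asymptoticRank`), while `Q̃(t) ≤ |ι|, |κ|, |μ|`
(`asymptoticSubrank_le_card₁₂₃`); so `R̃ ≤ Q̃` squeezes all six numbers together, and Theorem U
(`AbundantUnit.unit_of_asymptoticSubrank_eq_card`) finishes.  Contrapositive
(`ReversibleUnit.irreversible_of_not_unit`): every concise 111-abundant tensor that is not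
isomorphic to a unit tensor has `Q̃(t) < R̃(t)` — it is irreversible and is excluded as the
intermediate tensor of an `ω = 2` proof by the Christandl–Vrana–Zuiddam barrier.

References: [cite: BlaserLysikov2020, Thm. 16, Thm. 17]; [cite: ChristandlVranaZuiddam2021,
Def. 4, Thm. 9]; [cite: ChristandlLeGallLysikovZuiddam2025, Lemma 4.2];
[cite: JelisiejewLandsbergPal2023, Def. 1.9, Thm. 1.10].
-/

open scoped BigOperators Matrix
open Matrix

namespace Summit.MatrixMultiplication.MatrixMultiplication.Theorems

open Literature.Computability.AlgebraicComplexity Literature.Barriers.MatrixMultiplication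

namespace ReversibleUnit

open OneOneOneAlgebra AbundantUnit

section Flattening

variable {K : Type*} [Field K] {ι κ μ : Type*} [Fintype ι] [Fintype κ] [Fintype μ]

omit [Fintype κ] [Fintype μ] in
/-- The `x`-slices of an `A`-concise tensor are linearly independent. [folklore] -/
theorem linearIndependent_xSlices {t : ι → κ → μ → K} (hA : LinearIndependent K fun z => t z) :
    LinearIndependent K (xSlices t) := by
  rw [Fintype.linearIndependent_iff] at hA ⊢
  intro g hg z
  refine hA g ?_ z
  funext x y
  have h := congr_fun hg (x, y)
  simpa [Finset.sum_apply] using h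

omit [Fintype κ] [Fintype μ] in
/-- **The first flattening rank of an `A`-concise tensor is `|ι|`.** [folklore] -/
theorem flatteningRank_eq_card {t : ι → κ → μ → K} (hA : LinearIndependent K fun z => t z) :
    flatteningRank t = Fintype.card ι :=
  finrank_span_eq_card (linearIndependent_xSlices hA)

end Flattening

section TheoremR

variable {ι κ μ : Type} [Fintype ι] [Fintype κ] [Fintype μ] [DecidableEq ι] [DecidableEq κ]
  [DecidableEq μ]

omit [DecidableEq ι] [DecidableEq κ] [DecidableEq μ] in
/-- **A concise reversible tensor has cubic format and maximal asymptotic subrank**: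
`R̃(t) ≤ Q̃(t)` forces `|κ| = |μ| = |ι|` and `Q̃(t) = R̃(t) = |ι|`.
[cite: ChristandlLeGallLysikovZuiddam2025, Lemma 4.2] [cite: BlaserLysikov2020, §2.2] -/
theorem cubic_of_reversible (t : ι → κ → μ → ℂ) (ht : IsConcise3 t)
    (hrev : asymptoticRank t ≤ asymptoticSubrank ℂ t) :
    Fintype.card κ = Fintype.card ι ∧ Fintype.card μ = Fintype.card ι ∧
      asymptoticSubrank ℂ t = Fintype.card ι ∧ asymptoticRank t = Fintype.card ι := by
  obtain ⟨h1, h2, h3⟩ := flatteningRank_rotate_le_asymptoticRank t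
  rw [flatteningRank_eq_card ht.1] at h1
  rw [flatteningRank_eq_card ht.2.1] at h2
  rw [flatteningRank_eq_card ht.2.2] at h3
  obtain ⟨q1, q2, q3⟩ := asymptoticSubrank_le_card₁₂₃ t
  have hκι : (Fintype.card κ : ℝ) ≤ Fintype.card ι := h2.trans (hrev.trans q1)
  have hικ : (Fintype.card ι : ℝ) ≤ Fintype.card κ := h1.trans (hrev.trans q2)
  have hμι : (Fintype.card μ : ℝ) ≤ Fintype.card ι := h3.trans (hrev.trans q1)
  have hιμ : (Fintype.card ι : ℝ) ≤ Fintype.card μ := h1.trans (hrev.trans q3)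
  refine ⟨?_, ?_, le_antisymm q1 (h1.trans hrev), le_antisymm (hrev.trans q1) h1⟩
  · exact_mod_cast le_antisymm hκι hικ
  · exact_mod_cast le_antisymm hμι hιμ

/-- **Theorem R** (solo programme, claim c210).  A concise tensor `t ∈ ℂ^{ι×κ×μ}` (any format)
with `dim 𝔞(t) ≥ |ι|` and `R̃(t) ≤ Q̃(t)` has cubic format `d = |ι| = |κ| = |μ|` and is
isomorphic to the unit tensor `⟨d⟩`. [cite: BlaserLysikov2020, Thm. 17]
[cite: ChristandlVranaZuiddam2021, Thm. 9] -/
theorem unit_of_reversible (t : ι → κ → μ → ℂ) (ht : IsConcise3 t)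
    (hab : Fintype.card ι ≤ Module.finrank ℂ (LinearMap.ker (lin111 t)))
    (hrev : asymptoticRank t ≤ asymptoticSubrank ℂ t) :
    Fintype.card κ = Fintype.card ι ∧ Fintype.card μ = Fintype.card ι ∧
      TensorRestrictsTo (unitTensor ℂ (Fintype.card ι)) t ∧
      TensorRestrictsTo t (unitTensor ℂ (Fintype.card ι)) := by
  obtain ⟨hκ, hμ, hQ, -⟩ := cubic_of_reversible t ht hrev
  exact ⟨hκ, hμ, unit_of_asymptoticSubrank_eq_card t ht rfl hκ hμ hab hQ⟩

/-- Theorem R with 111-abundance in the form `Is111Abundant |ι| t` of [JLP23].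
[cite: JelisiejewLandsbergPal2023, Def. 1.9] -/
theorem unit_of_reversible_of_is111Abundant (t : ι → κ → μ → ℂ) (ht : IsConcise3 t)
    (hab : Is111Abundant (Fintype.card ι) t) (hrev : asymptoticRank t ≤ asymptoticSubrank ℂ t) :
    Fintype.card κ = Fintype.card ι ∧ Fintype.card μ = Fintype.card ι ∧
      TensorRestrictsTo (unitTensor ℂ (Fintype.card ι)) t ∧
      TensorRestrictsTo t (unitTensor ℂ (Fintype.card ι)) :=
  unit_of_reversible t ht (le_finrank_ker_of_is111Abundant hab) hrev

/-- **Irreversibility of the non-unit 111-abundant class** (contrapositive of Theorem R): a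
concise tensor with `dim 𝔞(t) ≥ |ι|` that is not isomorphic to `⟨|ι|⟩` has `Q̃(t) < R̃(t)`.
[cite: ChristandlVranaZuiddam2021, Def. 4, Thm. 9] [cite: BlaserLysikov2020, Thm. 16, Thm. 17] -/
theorem irreversible_of_not_unit (t : ι → κ → μ → ℂ) (ht : IsConcise3 t)
    (hab : Fintype.card ι ≤ Module.finrank ℂ (LinearMap.ker (lin111 t)))
    (hnu : ¬ (TensorRestrictsTo (unitTensor ℂ (Fintype.card ι)) t ∧
      TensorRestrictsTo t (unitTensor ℂ (Fintype.card ι)))) :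
    asymptoticSubrank ℂ t < asymptoticRank t := by
  by_contra h
  exact hnu (unit_of_reversible t ht hab (not_lt.1 h)).2.2

end TheoremR

end ReversibleUnit

end Summit.MatrixMultiplication.MatrixMultiplication.Theorems
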